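import Literature.NumberTheory.Automorphic.AdelicPiSchwartzBruhatDensity
import Literature.NumberTheory.Automorphic.AdelicSecondCountable
import Literature.Analysis.Distribution.SchwartzBumpExhaustion
import HarnessLib

/-!
# Monotone exhaustion of adelic boxes by real Schwartz–Bruhat functions

Topic `NumberTheory/Automorphic`; namespace `Literature.NumberTheory.Automorphic`. KERNEL MATHEMATICS
ONLY: no `def … : Prop` records, no `axiom`, no `sorry`.

For a number field `K` and a finite index type `ι` write `X = 𝔸_K^ι` with its archimedean and finite
coordinates `piArch : X → (K ⊗ ℝ)^ι`, `piFinite : X → (𝔸_K^∞)^ι` (`AdelicPiSchwartzBruhatFourier`)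
and `𝒮_ℝ(X) = piSchwartzBruhatReal K ι` (`AdelicPiSchwartzBruhatDensity`).

* §1 `smooth_mul_indicator_mem_piSchwartzBruhatReal` — for ANY smooth compactly supported real
  `φ` on `(K ⊗ ℝ)^ι` and any compact open `C ⊆ (𝔸_K^∞)^ι`, the tensor `v ↦ φ(v_∞) 𝟙_C(v_f)` is a
  real Schwartz–Bruhat function (generalises the tree's `bump_mul_indicator_mem_piSchwartzBruhatReal`,
  which takes a Mathlib `ContDiffBump`); "the indicator of a compact open set is Schwartz–Bruhat"
  is its finite leg.
* §2 `exists_piSchwartzBruhatReal_mono_tendsto_indicator_box` — **monotone Schwartz–Bruhat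
  exhaustion of a box** `U = {v | v_∞ ∈ B, v_f ∈ C}` (`B` open with compact closure in `(K ⊗ ℝ)^ι`,
  `C` compact open): tensors `Ψ_k = φ_k ⊗ 𝟙_C ∈ 𝒮_ℝ(X)` with `0 ≤ Ψ_k ≤ 𝟙_U`, compact support
  inside `U`, `k ↦ Ψ_k v` monotone, `Ψ_k = 1` on every compact `K₀ ⊆ U` for large `k`, and
  `Ψ_k v → 𝟙_U v` pointwise; the archimedean factors `φ_k` are the smooth monotone exhaustion of
  `B` of `Literature.Analysis.Distribution.exists_contDiff_mono_tendsto_indicator`.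
* §3 `measureReal_box_eq_mul_of_forall_integral_eq` / `measure_box_eq_smul_of_forall_integral_eq` —
  **from Schwartz–Bruhat-tested proportionality to boxes**: if two Borel measures `μ, ν` on `X`,
  finite on compact sets, satisfy `∫ Ψ dμ = κ ∫ Ψ dν` for every nonnegative compactly supported
  `Ψ ∈ 𝒮_ℝ(X)`, then `μ(U) = κ ν(U)` for every box `U` as above (dominated convergence along §2).

This is the device by which identities between (tempered, positive) measures tested against
Schwartz–Bruhat weights pass to identities on boxes / rectangles by monotone convergence
(Weil 1965, Chap. I n° 2, Lemmes 2–3 and Chap. V n° 51: "mesures tempérées"; Weil, *Basic Number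
Theory*, Ch. VII §2 for the standard functions on adele spaces).

## References

* A. Weil, *Sur la formule de Siegel dans la théorie des groupes classiques*, Acta Math. 113 (1965),
  Chap. I n° 2, Lemmes 2–3, p. 7 [Weil1965].
* A. Weil, *Basic Number Theory* (1967), Ch. VII §2 [WeilBNT1967].
* L. Hörmander, *The Analysis of Linear Partial Differential Operators I*, Thm. 1.4.1 [HormanderALPDO1].
-/

noncomputable section

open MeasureTheory NumberField NumberField.InfinitePlace NumberField.mixedEmbedding IsDedekindDomain
  Filter Topology Set Metric
open scoped SchwartzMap Classical ContDiff

namespace Literature.NumberTheory.Automorphic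

variable (K : Type) [Field K] [NumberField K] (ι : Type) [Fintype ι]

omit [Fintype ι] in
/-- `(𝔸_K^∞)^ι` is Hausdorff. [cite: WeilBNT1967, Ch. VII §2] -/
private theorem t2Space_piFiniteAdele : T2Space (ι → FiniteAdeleRing (𝓞 K) K) := by
  haveI : T2Space (FiniteAdeleRing (𝓞 K) K) := inferInstanceAs <| T2Space
    (RestrictedProduct (fun w : IsDedekindDomain.HeightOneSpectrum (𝓞 K) => w.adicCompletion K)
      (fun w => (w.adicCompletionIntegers K : Set (w.adicCompletion K))) Filter.cofinite)
  infer_instance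

omit [Fintype ι] in
/-- `𝔸_K^ι` is Hausdorff (Mathlib instances on `K_∞ × 𝔸_K^∞`). [cite: WeilBNT1967, Ch. VII §2] -/
private theorem t2Space_piAdele : T2Space (ι → AdeleRing (𝓞 K) K) := by
  haveI : T2Space (FiniteAdeleRing (𝓞 K) K) := inferInstanceAs <| T2Space
    (RestrictedProduct (fun w : IsDedekindDomain.HeightOneSpectrum (𝓞 K) => w.adicCompletion K)
      (fun w => (w.adicCompletionIntegers K : Set (w.adicCompletion K))) Filter.cofinite)
  haveI : T2Space (InfiniteAdeleRing K) :=
    inferInstanceAs <| T2Space ((w : InfinitePlace K) → w.Completion)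
  haveI : T2Space (AdeleRing (𝓞 K) K) :=
    inferInstanceAs <| T2Space (InfiniteAdeleRing K × FiniteAdeleRing (𝓞 K) K)
  infer_instance

variable {K ι}

/-! ### §1 Smooth compactly supported archimedean factor times a compact-open indicator -/

/-- **Tensors `φ ⊗ 𝟙_C` are real Schwartz–Bruhat functions**: for `φ : (K ⊗ ℝ)^ι → ℝ` smooth with
compact support and `C ⊆ (𝔸_K^∞)^ι` compact open, `v ↦ φ(v_∞) · 𝟙_C(v_f) ∈ 𝒮_ℝ(𝔸_K^ι)` (the
archimedean factor is Schwartz by Mathlib `HasCompactSupport.toSchwartzMap`; the indicator of a compact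
open set is locally constant of compact support, i.e. Schwartz–Bruhat). [cite: WeilBNT1967, Ch. VII §2] -/
theorem smooth_mul_indicator_mem_piSchwartzBruhatReal {φ : (ι → mixedSpace K) → ℝ}
    (hφc : HasCompactSupport φ) (hφd : ContDiff ℝ ∞ φ)
    {C : Set (ι → FiniteAdeleRing (𝓞 K) K)} (hCc : IsCompact C) (hCo : IsOpen C) :
    (fun v => φ (piArch K ι v) * C.indicator 1 (piFinite K ι v)) ∈ piSchwartzBruhatReal K ι := by
  rw [mem_piSchwartzBruhatReal_iff]
  have hbs : HasCompactSupport fun x => ((φ x : ℝ) : ℂ) := hφc.comp_left Complex.ofReal_zero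
  have hbd : ContDiff ℝ ((⊤ : ℕ∞) : WithTop ℕ∞) fun x => ((φ x : ℝ) : ℂ) :=
    Complex.ofRealCLM.contDiff.comp hφd
  refine mem_piSchwartzBruhat ⟨hbs.toSchwartzMap hbd, fun y => (C.indicator 1 y : ℝ), ⟨?_, ?_⟩, ?_⟩
  · -- locally constant: `C` is clopen
    haveI := t2Space_piFiniteAdele K ι
    have hCl : IsClopen C := ⟨hCc.isClosed, hCo⟩
    refine (IsLocallyConstant.iff_exists_open _).mpr fun y => ?_
    by_cases hy : y ∈ C
    · exact ⟨C, hCo, hy, fun y' hy' => by simp [indicator_of_mem hy', indicator_of_mem hy]⟩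
    · exact ⟨Cᶜ, hCl.compl.isOpen, hy, fun y' hy' => by
        simp [indicator_of_notMem (show y' ∉ C from hy'), indicator_of_notMem hy]⟩
  · refine HasCompactSupport.of_support_subset_isCompact hCc fun y hy => ?_
    by_contra hyC
    exact hy (by simp [indicator_of_notMem hyC])
  · funext v
    rw [Complex.ofReal_mul]
    rfl

omit [Fintype ι] in
/-- Support of a tensor `φ ⊗ 𝟙_C` (`C` compact): `tsupport ⊆ piArch⁻¹(tsupport φ) ∩ piFinite⁻¹(C)`.
[cite: WeilBNT1967, Ch. VII §2] -/
theorem tsupport_mul_indicator_subset (φ : (ι → mixedSpace K) → ℝ)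
    {C : Set (ι → FiniteAdeleRing (𝓞 K) K)} (hCc : IsCompact C) :
    tsupport (fun v => φ (piArch K ι v) * C.indicator 1 (piFinite K ι v)) ⊆
      piArch K ι ⁻¹' tsupport φ ∩ piFinite K ι ⁻¹' C := by
  haveI := t2Space_piFiniteAdele K ι
  refine closure_minimal (fun v hv => ?_)
    (((isClosed_tsupport _).preimage continuous_piArch).inter
      (hCc.isClosed.preimage continuous_piFinite))
  rw [Function.mem_support] at hv
  constructor
  · exact subset_tsupport _ (fun h => hv (by simp only [h, zero_mul]))
  · by_contra h
    exact hv (by simp only [indicator_of_notMem (show piFinite K ι v ∉ C from h), mul_zero])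

/-- A tensor `φ ⊗ 𝟙_C` with `φ` compactly supported and `C` compact has compact support in `𝔸_K^ι`.
[cite: WeilBNT1967, Ch. VII §2] -/
theorem hasCompactSupport_mul_indicator {φ : (ι → mixedSpace K) → ℝ} (hφc : HasCompactSupport φ)
    {C : Set (ι → FiniteAdeleRing (𝓞 K) K)} (hCc : IsCompact C) :
    HasCompactSupport (fun v => φ (piArch K ι v) * C.indicator 1 (piFinite K ι v)) := by
  obtain ⟨r, hr⟩ := hφc.isCompact.isBounded.subset_closedBall 0
  refine (isCompact_piAdeleBox (K := K) (ι := ι) 0 r hCc).of_isClosed_subset (isClosed_tsupport _)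
    ((tsupport_mul_indicator_subset φ hCc).trans ?_)
  exact inter_subset_inter_left _ (preimage_mono hr)

/-! ### §2 Monotone exhaustion of a box -/

/-- **Monotone Schwartz–Bruhat exhaustion of an adelic box.** Let `B ⊆ (K ⊗ ℝ)^ι` be open with
compact closure and `C ⊆ (𝔸_K^∞)^ι` compact open; put `U = piArch⁻¹(B) ∩ piFinite⁻¹(C) ⊆ 𝔸_K^ι`.
There are smooth compactly supported `φ_k` on `(K ⊗ ℝ)^ι` with `tsupport φ_k ⊆ B` such that the
tensors `Ψ_k = φ_k ⊗ 𝟙_C` lie in `𝒮_ℝ(𝔸_K^ι)`, are continuous with compact support inside `U`,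
satisfy `0 ≤ Ψ_k ≤ 1`, `Ψ_k ≤ 𝟙_U`, `k ↦ Ψ_k v` is monotone, `Ψ_k = 1` on every compact `K₀ ⊆ U`
for all large `k`, and `Ψ_k v → 𝟙_U v` for every `v`.
[cite: Weil1965, Chap. I n° 2, Lemme 3, p. 7] -/
theorem exists_piSchwartzBruhatReal_mono_tendsto_indicator_box
    {B : Set (ι → mixedSpace K)} (hB : IsOpen B) (hBc : IsCompact (closure B))
    {C : Set (ι → FiniteAdeleRing (𝓞 K) K)} (hCc : IsCompact C) (hCo : IsOpen C) :
    ∃ (φ : ℕ → (ι → mixedSpace K) → ℝ) (Ψ : ℕ → (ι → AdeleRing (𝓞 K) K) → ℝ),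
      (∀ k v, Ψ k v = φ k (piArch K ι v) * C.indicator 1 (piFinite K ι v)) ∧
      (∀ k, ContDiff ℝ ∞ (φ k)) ∧
      (∀ k, HasCompactSupport (φ k)) ∧
      (∀ k, tsupport (φ k) ⊆ B) ∧
      (∀ k, Ψ k ∈ piSchwartzBruhatReal K ι) ∧
      (∀ k, Continuous (Ψ k)) ∧
      (∀ k, HasCompactSupport (Ψ k)) ∧
      (∀ k, tsupport (Ψ k) ⊆ piArch K ι ⁻¹' B ∩ piFinite K ι ⁻¹' C) ∧
      (∀ k v, 0 ≤ Ψ k v) ∧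
      (∀ k v, Ψ k v ≤ 1) ∧
      (∀ k v, Ψ k v ≤ (piArch K ι ⁻¹' B ∩ piFinite K ι ⁻¹' C).indicator 1 v) ∧
      (∀ v, Monotone fun k => Ψ k v) ∧
      (∀ K₀ ⊆ piArch K ι ⁻¹' B ∩ piFinite K ι ⁻¹' C, IsCompact K₀ →
        ∀ᶠ k in atTop, ∀ v ∈ K₀, Ψ k v = 1) ∧
      (∀ v, Tendsto (fun k => Ψ k v) atTop
        (𝓝 ((piArch K ι ⁻¹' B ∩ piFinite K ι ⁻¹' C).indicator 1 v))) := by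
  obtain ⟨φ, hd, hc, hs, h0, h1, hB1, hm, hK, ht⟩ :=
    Literature.Analysis.Distribution.exists_contDiff_mono_tendsto_indicator hB hBc
  set U : Set (ι → AdeleRing (𝓞 K) K) := piArch K ι ⁻¹' B ∩ piFinite K ι ⁻¹' C with hU
  set Ψ : ℕ → (ι → AdeleRing (𝓞 K) K) → ℝ := fun k v =>
    φ k (piArch K ι v) * C.indicator 1 (piFinite K ι v) with hΨ
  have hΨmem : ∀ k, Ψ k ∈ piSchwartzBruhatReal K ι := fun k =>
    smooth_mul_indicator_mem_piSchwartzBruhatReal (hc k) (hd k) hCc hCo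
  -- values: `Ψ_k v = φ_k v_∞` on `piFinite⁻¹ C`, `0` off it
  have hΨin : ∀ k v, piFinite K ι v ∈ C → Ψ k v = φ k (piArch K ι v) := fun k v hv => by
    simp only [hΨ, indicator_of_mem hv, Pi.one_apply, mul_one]
  have hΨout : ∀ k v, piFinite K ι v ∉ C → Ψ k v = 0 := fun k v hv => by
    simp only [hΨ, indicator_of_notMem hv, mul_zero]
  have hΨ01 : ∀ k v, 0 ≤ Ψ k v ∧ Ψ k v ≤ 1 := fun k v => by
    by_cases hv : piFinite K ι v ∈ C
    · rw [hΨin k v hv]; exact ⟨h0 k _, h1 k _⟩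
    · rw [hΨout k v hv]; exact ⟨le_rfl, zero_le_one⟩
  have htU : ∀ k, tsupport (Ψ k) ⊆ U := fun k =>
    (tsupport_mul_indicator_subset (φ k) hCc).trans (inter_subset_inter_left _ (preimage_mono (hs k)))
  refine ⟨φ, Ψ, fun k v => rfl, hd, hc, hs, hΨmem,
    fun k => continuous_of_mem_piSchwartzBruhatReal (hΨmem k),
    fun k => hasCompactSupport_mul_indicator (hc k) hCc, htU,
    fun k v => (hΨ01 k v).1, fun k v => (hΨ01 k v).2, fun k v => ?_, fun v => ?_,
    fun K₀ hK₀U hK₀ => ?_, fun v => ?_⟩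
  · -- `≤ 𝟙_U`
    by_cases hv : v ∈ U
    · simp only [indicator_of_mem hv, Pi.one_apply]; exact (hΨ01 k v).2
    · rw [image_eq_zero_of_notMem_tsupport fun h => hv (htU k h), indicator_of_notMem hv]
  · -- monotone in `k`
    intro k l hkl
    show Ψ k v ≤ Ψ l v
    by_cases hv : piFinite K ι v ∈ C
    · rw [hΨin k v hv, hΨin l v hv]; exact hm _ hkl
    · rw [hΨout k v hv, hΨout l v hv]
  · -- eventually `1` on compact subsets of the box
    have himg : piArch K ι '' K₀ ⊆ B := by
      rintro _ ⟨v, hv, rfl⟩; exact (hK₀U hv).1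
    refine (hK _ himg (hK₀.image continuous_piArch)).mono fun k hk v hv => ?_
    rw [hΨin k v (hK₀U hv).2]
    exact hk _ (mem_image_of_mem _ hv)
  · -- pointwise convergence
    by_cases hv : piFinite K ι v ∈ C
    · have hlim := ht (piArch K ι v)
      have heq : (fun k => Ψ k v) = fun k => φ k (piArch K ι v) := funext fun k => hΨin k v hv
      rw [heq]
      convert hlim using 2
      by_cases hvB : piArch K ι v ∈ B
      · rw [indicator_of_mem (show v ∈ U from ⟨hvB, hv⟩), indicator_of_mem hvB]; rfl
      · rw [indicator_of_notMem (show v ∉ U from fun h => hvB h.1), indicator_of_notMem hvB]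
    · have heq : (fun k => Ψ k v) = fun _ => 0 := funext fun k => hΨout k v hv
      rw [heq, indicator_of_notMem (show v ∉ U from fun h => hv h.2)]
      exact tendsto_const_nhds

/-! ### §3 From Schwartz–Bruhat-tested identities to boxes -/

/-- The closed box `piArch⁻¹(closure B) ∩ piFinite⁻¹(C)` is compact when `closure B` and `C` are.
[cite: WeilBNT1967, Ch. VII §2] -/
theorem isCompact_piArch_preimage_closure_inter {B : Set (ι → mixedSpace K)}
    (hBc : IsCompact (closure B)) {C : Set (ι → FiniteAdeleRing (𝓞 K) K)} (hCc : IsCompact C) :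
    IsCompact (piArch K ι ⁻¹' closure B ∩ piFinite K ι ⁻¹' C) := by
  haveI := t2Space_piFiniteAdele K ι
  obtain ⟨r, hr⟩ := hBc.isBounded.subset_closedBall 0
  exact (isCompact_piAdeleBox (K := K) (ι := ι) 0 r hCc).of_isClosed_subset
    ((isClosed_closure.preimage continuous_piArch).inter (hCc.isClosed.preimage continuous_piFinite))
    (inter_subset_inter_left _ (preimage_mono hr))

section Measures

variable [MeasurableSpace (AdeleRing (𝓞 K) K)] [BorelSpace (AdeleRing (𝓞 K) K)]

omit [Fintype ι] in
/-- `𝔸_K^ι` carries the Borel σ-algebra (finite product of second countable Borel factors; tree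
`secondCountableTopology_adeleRing`). [cite: WeilBNT1967, Ch. VII §2] -/
private theorem borelSpace_pi [Finite ι] : BorelSpace (ι → AdeleRing (𝓞 K) K) := by
  haveI := secondCountableTopology_adeleRing (K := K)
  infer_instance

/-- **Integrals of the box exhaustion converge to the measure of the box** for every Borel measure
finite on compact sets (dominated convergence, dominated by the indicator of the compact closed box).
[cite: Weil1965, Chap. I n° 2, Lemme 3, p. 7] -/
theorem tendsto_integral_of_exhaustion (ρ : Measure (ι → AdeleRing (𝓞 K) K))
    [IsFiniteMeasureOnCompacts ρ] {U K' : Set (ι → AdeleRing (𝓞 K) K)} (hUo : IsOpen U)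
    (hK' : IsCompact K') (hUK' : U ⊆ K') {Ψ : ℕ → (ι → AdeleRing (𝓞 K) K) → ℝ}
    (hcont : ∀ k, Continuous (Ψ k)) (h0 : ∀ k v, 0 ≤ Ψ k v) (hle : ∀ k v, Ψ k v ≤ U.indicator 1 v)
    (ht : ∀ v, Tendsto (fun k => Ψ k v) atTop (𝓝 (U.indicator 1 v))) :
    Tendsto (fun k => ∫ v, Ψ k v ∂ρ) atTop (𝓝 (ρ.real U)) := by
  haveI := borelSpace_pi (K := K) (ι := ι)
  haveI := t2Space_piAdele K ι
  rw [← integral_indicator_one hUo.measurableSet]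
  refine tendsto_integral_of_dominated_convergence (K'.indicator 1)
    (fun k => (hcont k).aestronglyMeasurable) ?_ (fun k => Eventually.of_forall fun v => ?_)
    (Eventually.of_forall ht)
  · exact (integrable_indicator_iff hK'.measurableSet).mpr
      (integrableOn_const (hK'.measure_lt_top (μ := ρ)).ne)
  · rw [Real.norm_eq_abs, abs_of_nonneg (h0 k v)]
    refine (hle k v).trans ?_
    by_cases hv : v ∈ K'
    · by_cases hvU : v ∈ U
      · simp only [indicator_of_mem hvU, indicator_of_mem hv, Pi.one_apply, le_refl]
      · simp only [indicator_of_notMem hvU, indicator_of_mem hv, Pi.one_apply, zero_le_one]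
    · simp only [indicator_of_notMem (fun h => hv (hUK' h)), indicator_of_notMem hv, le_refl]

/-- **Schwartz–Bruhat-tested proportionality passes to boxes (real form).** If `μ, ν` are Borel
measures on `𝔸_K^ι` finite on compact sets and `∫ Ψ dμ = κ · ∫ Ψ dν` for every nonnegative compactly
supported `Ψ ∈ 𝒮_ℝ(𝔸_K^ι)`, then `μ(U) = κ · ν(U)` for every box `U = piArch⁻¹(B) ∩ piFinite⁻¹(C)`
with `B` open of compact closure and `C` compact open. (Weil's "une distribution tempérée positive est
une mesure", read on boxes.) [cite: Weil1965, Chap. I n° 2, Lemme 3, p. 7] -/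
theorem measureReal_box_eq_mul_of_forall_integral_eq (μ ν : Measure (ι → AdeleRing (𝓞 K) K))
    [IsFiniteMeasureOnCompacts μ] [IsFiniteMeasureOnCompacts ν] (κ : ℝ)
    (h : ∀ Ψ ∈ piSchwartzBruhatReal K ι, HasCompactSupport Ψ → (∀ v, 0 ≤ Ψ v) →
      ∫ v, Ψ v ∂μ = κ * ∫ v, Ψ v ∂ν)
    {B : Set (ι → mixedSpace K)} (hB : IsOpen B) (hBc : IsCompact (closure B))
    {C : Set (ι → FiniteAdeleRing (𝓞 K) K)} (hCc : IsCompact C) (hCo : IsOpen C) :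
    μ.real (piArch K ι ⁻¹' B ∩ piFinite K ι ⁻¹' C) =
      κ * ν.real (piArch K ι ⁻¹' B ∩ piFinite K ι ⁻¹' C) := by
  obtain ⟨φ, Ψ, -, -, -, -, hmem, hcont, hcs, -, h0, -, hle, -, -, ht⟩ :=
    exists_piSchwartzBruhatReal_mono_tendsto_indicator_box (K := K) (ι := ι) hB hBc hCc hCo
  have hUo : IsOpen (piArch K ι ⁻¹' B ∩ piFinite K ι ⁻¹' C) :=
    (hB.preimage continuous_piArch).inter (hCo.preimage continuous_piFinite)
  have hK' := isCompact_piArch_preimage_closure_inter (K := K) (ι := ι) hBc hCc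
  have hUK' : piArch K ι ⁻¹' B ∩ piFinite K ι ⁻¹' C ⊆ piArch K ι ⁻¹' closure B ∩ piFinite K ι ⁻¹' C :=
    inter_subset_inter_left _ (preimage_mono subset_closure)
  have h1 := tendsto_integral_of_exhaustion μ hUo hK' hUK' hcont h0 hle ht
  have h2 : Tendsto (fun k => ∫ v, Ψ k v ∂μ) atTop
      (𝓝 (κ * ν.real (piArch K ι ⁻¹' B ∩ piFinite K ι ⁻¹' C))) := by
    refine ((tendsto_integral_of_exhaustion ν hUo hK' hUK' hcont h0 hle ht).const_mul κ).congr
      fun k => ?_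
    exact (h (Ψ k) (hmem k) (hcs k) (h0 k)).symm
  exact tendsto_nhds_unique h1 h2

/-- **Schwartz–Bruhat-tested proportionality passes to boxes (`ℝ≥0∞` form).** Under the hypotheses of
`measureReal_box_eq_mul_of_forall_integral_eq` with `κ ≥ 0`: `μ U = κ • ν U` in `ℝ≥0∞` for every box
`U`. [cite: Weil1965, Chap. I n° 2, Lemme 3, p. 7] -/
theorem measure_box_eq_smul_of_forall_integral_eq (μ ν : Measure (ι → AdeleRing (𝓞 K) K))
    [IsFiniteMeasureOnCompacts μ] [IsFiniteMeasureOnCompacts ν] (κ : NNReal)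
    (h : ∀ Ψ ∈ piSchwartzBruhatReal K ι, HasCompactSupport Ψ → (∀ v, 0 ≤ Ψ v) →
      ∫ v, Ψ v ∂μ = κ * ∫ v, Ψ v ∂ν)
    {B : Set (ι → mixedSpace K)} (hB : IsOpen B) (hBc : IsCompact (closure B))
    {C : Set (ι → FiniteAdeleRing (𝓞 K) K)} (hCc : IsCompact C) (hCo : IsOpen C) :
    μ (piArch K ι ⁻¹' B ∩ piFinite K ι ⁻¹' C) = κ * ν (piArch K ι ⁻¹' B ∩ piFinite K ι ⁻¹' C) := by
  haveI := t2Space_piAdele K ι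
  have hr := measureReal_box_eq_mul_of_forall_integral_eq μ ν κ h hB hBc hCc hCo
  have hK' := isCompact_piArch_preimage_closure_inter (K := K) (ι := ι) hBc hCc
  have hUK' : piArch K ι ⁻¹' B ∩ piFinite K ι ⁻¹' C ⊆ piArch K ι ⁻¹' closure B ∩ piFinite K ι ⁻¹' C :=
    inter_subset_inter_left _ (preimage_mono subset_closure)
  have hμ : μ (piArch K ι ⁻¹' B ∩ piFinite K ι ⁻¹' C) ≠ ⊤ :=
    ((measure_mono hUK').trans_lt (hK'.measure_lt_top (μ := μ))).ne
  have hν : ν (piArch K ι ⁻¹' B ∩ piFinite K ι ⁻¹' C) ≠ ⊤ :=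
    ((measure_mono hUK').trans_lt (hK'.measure_lt_top (μ := ν))).ne
  rw [measureReal_def, measureReal_def] at hr
  rw [← ENNReal.toReal_eq_toReal_iff' hμ (ENNReal.mul_ne_top ENNReal.coe_ne_top hν),
    ENNReal.toReal_mul, ENNReal.coe_toReal]
  exact hr

end Measures

end Literature.NumberTheory.Automorphic
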